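import Summits.Schanuel.Schanuel.Theorems.RootDecomp1KDegreeLadder08
import Literature.NumberTheory.DiophantineApproximation.RidoutIntegers

/-!
# RootDecomp1KXLinear — lens 1, generation 45, node 2 (g45b) «X-LINEAR THIN FIBRE: ALL CURVES A(Y) + x·B(Y) WITH deg B < deg A, HYPOTHESIS-FREE» (RULE K-R31 (ii) second clause + K-R32 (i); CLAIM L2261, ACK/CHECKLIST K-g45b L2262, NODE L2274 / REQUEST L2275, critic VERDICT L2278: CLEARED — THEOREM ×2; port shape L2282 (d)) — continuation (RootDecomp1KXLinear01): XLinearCore — the 2-adic core lemma + Ridout step (by tree name)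

(lens-1 g45b HOME kernel K₂ = HOME/decomp-schanuel-lens-1/g45b/DLxlinear.lean db54a0a5…, 3838 l = the DegreeLadder ed. 3 prefix (tree: RootDecomp1KDegreeLadder01–09) + `XLinearCore` (l.2184–2562) + §X (l.2564–3836); imports SkelCell01 + Literature RidoutIntegers (BUILT on the farm since 20:13Z). Port by census-1 gen 19 as `RootDecomp1KXLinear01`–`05`: 01 = XLinearCore (namespace `…RootDecomp1KXLinearCore`; the 2-adic CORE LEMMA `core` — second-order approximation of the nearest e-th root by the rationally shifted point — `roots_structure`, and Step 5 `ridout_step` with `Ridout.padicRoth_int` BY TREE NAME; imports tree DegreeLadder08 + Literature RidoutIntegers); 02–05 = §X (namespace `…RootDecomp1KXLinear`): 02 = `xLinP`, `gap`, level points `OnLevel`, Steps 1a/1b/2/6, 2-adic infrastructure (first half); 03 = 2-adic infrastructure (second half: the shifted integer, valuation bookkeeping); 04 = the composition `levels_finite` → `thinFibreAt_xLinP` (scoped `maxHeartbeats 800000` ×2 as in K) + common rational roots; 05 = pole gap e = 1 `thinFibreAt_xLinP_gapOne` (no Ridout), `thinFibreAt_xLinear`, `thinFibreAt_xLinear_of_lt`,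 the typed classes `XLinearGap2` / `XLinearLt` with `thinFibreAt_of_xLinearGap2` / `thinFibreAt_of_xLinearLt` / `thinFibreAt_sqMulP'` (all c ≠ 0), positions and non-members (`not_xLinearGap2_lineP`, `cuspP`), the consumer `xLinear_nonvanishing (hm : 2 ≤ m) (hρ : SkelLiouvilleFix m ρ) (A B) (hB : B ≠ 0) (hlt : B.natDegree < A.natDegree) : aeval ρ A + liouvilleNumber 2 * aeval ρ B ≠ 0` — ALL HYPOTHESIS-FREE.
PORT EDITS (critic L2282 (d)): the DegreeLadder prefix dropped (tree parts imported); the `(hR : PadicRothInt)` binder REMOVED from the ten decls that carried it and `Literature.NumberTheory.DiophantineApproximation.Ridout.padicRoth_int` fed directly at the one use site in `ridout_step`; the §HypFree primed twins and `padicRothInt_holds` DROPPED (the unprimed names now denote the binder-free forms); `open …DegreeLadder (PadicRothInt pTwo)` ↦ `(pTwo)`; two linter options dropped; 22 one-line docstrings added; seven generic p-adic/arithmetic helpers private (`norm_natCast_le_one`, `norm_two`, `norm_two_pow`, `norm_intCast_le_one'`, `factorial_sub_ge`, `natDegree_linear`, `den_dvd_leadingCoeff` — dedup-safety vs DegreeLadder08's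 private 2-adic lemmas) with per-part private copies, plus private copies of the DegreeLadder port's private ℓ₂/psNumer lemmas where §X uses them; statements and proofs otherwise verbatim. `--supports stmt-Schanuel-33364`; no census credit carried; rung 0 — nothing here proves Schanuel; `ThinFibre m₀` (all curves) stays OPEN / IDEA-NEEDED.)
-/

/-!
# RootDecomp1K — x-linear thin fibres: the 2-adic CORE LEMMA (lens-1 g45 → g46 PREP; NOT part of NODE g45)

This file is the head start for the g46 target of record (STANDING-RECORD-lens1 §8, the «x-LINEAR thin fibre»
`ThinFibreAt m₀ (A(Y) + x·B(Y))`, `deg B < deg A`): it proves STEPS 3–4 of that blueprint in abstract form,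
over `\overline{ℚ₂} = PadicAlgCl 2`, with explicit constants.

* `roots_structure` : for `e ≠ 0`, `γ ≠ 0` the `e`-th roots of `γ` form a finset `T` of cardinality `e` with
  `u ^ e − γ = ∏_{ζ ∈ T} (u − ζ)` for every `u` and the derivative identity `∏_{ζ' ∈ T ∖ {ζ}} (ζ − ζ') = e·ζ^{e−1}`.
* `core` : if `‖u‖ = 1` and `‖a·u·(u^e − γ) + 2^t·(c₁·u^e + c₂)‖ ≤ δ` (`0 ≤ δ ≤ 1`, `‖γ‖ = 1`, `a ≠ 0`), then for some
  `e`-th root `ζ` of `γ`,  `‖u + 2^t·θ − ζ‖ ≤ C·(δ + 4^{−t})` with the RATIONAL SHIFT `θ = (c₁γ + c₂)/(a·e·γ)`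
  (independent of `ζ`, and in `ℚ` when `a, γ, c₁, c₂ ∈ ℚ`) and a constant `C = C(a, γ, c₁, c₂, e)` — i.e. the
  nearest root is approximated to SECOND order `max(δ, 4^{−t})` by the shifted point, although `u` itself is only
  within first order `max(δ, 2^{−t})` of `ζ`.  This is the move that turns Roth-trivial precision `t` into `2t` and
  lets one-prime integer Ridout (`Ridout.padicRoth_int`) finish (blueprint Step 5).

What g46 still has to do (blueprint Steps 1, 2, 5, 6): the valuation bookkeeping `q = 2^t·q′`, `e·t = N! + κ`;
the expansion of `2^{ta}·(A(r) + s_N B(r))` into `u^{b}·[a_a·u·(u^e − γ)·u^{-1}… ]` form feeding `core` with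
`δ ≍ max(4^{−t}, 2^{−E})`; Ridout per root `ζ ∈ T` (finite union); the finite-to-one Step 6; assembly into
`ThinFibreAt`.  Nothing here is claimed at NODE g45; the file is Mathlib-only and sorry-free.
-/

namespace Summit.Schanuel.Schanuel.Theorems.RootDecomp1KXLinearCore

open Polynomial Finset
open Summit.Schanuel.Schanuel.Theorems.RootDecomp1KDegreeLadder (pTwo)

/-- `‖(n : \overline{ℚ₂})‖ ≤ 1`. -/
private theorem norm_natCast_le_one (n : ℕ) : ‖(n : PadicAlgCl 2)‖ ≤ 1 := by
  have h1 : (n : PadicAlgCl 2) = algebraMap ℚ_[2] (PadicAlgCl 2) (n : ℚ_[2]) := (map_natCast _ n).symm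
  rw [h1, PadicAlgCl.norm_extends]
  have h2 : ((n : ℤ_[2]) : ℚ_[2]) = (n : ℚ_[2]) := by simp
  rw [← h2]
  exact PadicInt.norm_le_one _

/-- `‖2‖₂ = 1/2` in `PadicAlgCl 2`. -/
private theorem norm_two : ‖(2 : PadicAlgCl 2)‖ = 1 / 2 := by
  have h1 : ((2 : ℕ) : PadicAlgCl 2) = algebraMap ℚ_[2] (PadicAlgCl 2) ((2 : ℕ) : ℚ_[2]) :=
    (map_natCast _ 2).symm
  have h2 : ‖((2 : ℕ) : ℚ_[2])‖ = (↑(2 : ℕ) : ℝ)⁻¹ := Padic.norm_p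
  have h3 : ‖((2 : ℕ) : PadicAlgCl 2)‖ = 1 / 2 := by rw [h1, PadicAlgCl.norm_extends, h2]; norm_num
  simpa using h3

/-- `‖2^t‖₂ = 2^{−t}`. -/
private theorem norm_two_pow (t : ℕ) : ‖(2 : PadicAlgCl 2) ^ t‖ = (1 / 2 : ℝ) ^ t := by
  rw [norm_pow, norm_two]

/-- The `e`-th roots of `γ ≠ 0` in `\overline{ℚ₂}`: a finset of cardinality `e`, the product formula for
`u ^ e − γ`, and the derivative identity at each root. -/
theorem roots_structure [DecidableEq (PadicAlgCl 2)] (e : ℕ) (he : e ≠ 0) (γ : PadicAlgCl 2) (hγ : γ ≠ 0) :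
    ∃ T : Finset (PadicAlgCl 2), T.card = e ∧ (∀ ζ ∈ T, ζ ^ e = γ) ∧
      (∀ u : PadicAlgCl 2, u ^ e - γ = ∏ ζ ∈ T, (u - ζ)) ∧
      (∀ ζ ∈ T, ∏ ζ' ∈ T.erase ζ, (ζ - ζ') = (e : PadicAlgCl 2) * ζ ^ (e - 1)) := by
  set p : (PadicAlgCl 2)[X] := X ^ e - C γ with hp
  have hmonic : p.Monic := monic_X_pow_sub_C γ he
  have hsep : p.Separable := separable_X_pow_sub_C γ (by exact_mod_cast he) hγ
  have hnodup : p.roots.Nodup := nodup_roots hsep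
  have hcardr : p.roots.card = p.natDegree := IsAlgClosed.card_roots_eq_natDegree
  have hprod : (p.roots.map fun x => X - C x).prod = p :=
    prod_multiset_X_sub_C_of_monic_of_roots_card_eq hmonic hcardr
  have hval : p.roots.toFinset.val = p.roots := by
    rw [Multiset.toFinset_val, Multiset.Nodup.dedup hnodup]
  have hevp : ∀ u : PadicAlgCl 2, eval u p = u ^ e - γ := fun u => by
    rw [hp, eval_sub, eval_pow, eval_X, eval_C]
  refine ⟨p.roots.toFinset, ?_, ?_, ?_, ?_⟩
  · rw [Multiset.toFinset_card_of_nodup hnodup, hcardr, hp, natDegree_X_pow_sub_C]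
  · intro ζ hζ
    have h1 : eval ζ p = 0 := (mem_roots hmonic.ne_zero).mp (Multiset.mem_toFinset.mp hζ)
    rw [hevp] at h1
    exact sub_eq_zero.mp h1
  · intro u
    rw [← hevp u, Finset.prod_eq_multiset_prod, hval]
    conv_lhs => rw [← hprod]
    rw [eval_multiset_prod, Multiset.map_map]
    congr 1
    refine Multiset.map_congr rfl fun x _ => ?_
    simp
  · intro ζ hζ
    have hmem : ζ ∈ p.roots := Multiset.mem_toFinset.mp hζ
    have hder := eval_multiset_prod_X_sub_C_derivative hmem
    rw [hprod] at hder
    have hd2 : eval ζ (derivative p) = (e : PadicAlgCl 2) * ζ ^ (e - 1) := by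
      rw [hp, derivative_sub, derivative_X_pow, derivative_C, sub_zero, eval_mul, eval_pow, eval_X, eval_C]
    have hval2 : (p.roots.toFinset.erase ζ).val = p.roots.erase ζ := by
      rw [Finset.erase_val, hval]
    rw [Finset.prod_eq_multiset_prod, hval2, ← hder, hd2]

set_option maxHeartbeats 800000 in
/-- **Core lemma (blueprint Steps 3–4).**  Second-order approximation of the nearest `e`-th root of `γ` by the
rationally shifted point `u + 2^t·θ`, `θ = (c₁γ + c₂)/(a·e·γ)`. -/
theorem core (e : ℕ) (he : e ≠ 0) (a γ c₁ c₂ : PadicAlgCl 2) (ha : a ≠ 0) (hγ1 : ‖γ‖ = 1) :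
    ∃ C : ℝ, 0 < C ∧ ∀ (t : ℕ) (δ : ℝ), 0 ≤ δ → δ ≤ 1 → ∀ u : PadicAlgCl 2, ‖u‖ = 1 →
      ‖a * u * (u ^ e - γ) + (2 : PadicAlgCl 2) ^ t * (c₁ * u ^ e + c₂)‖ ≤ δ →
      ∃ ζ : PadicAlgCl 2, ζ ^ e = γ ∧
        ‖u + (2 : PadicAlgCl 2) ^ t * ((c₁ * γ + c₂) / (a * e * γ)) - ζ‖ ≤ C * (δ + (1 / 4 : ℝ) ^ t) := by
  classical
  have hγ : γ ≠ 0 := norm_pos_iff.mp (by rw [hγ1]; exact one_pos)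
  have he' : (e : PadicAlgCl 2) ≠ 0 := Nat.cast_ne_zero.mpr he
  obtain ⟨T, hcard, hroot, hprod, hder⟩ := roots_structure e he γ hγ
  have hTne : T.Nonempty := Finset.card_pos.mp (by rw [hcard]; exact Nat.pos_of_ne_zero he)
  have hνpos : 0 < ‖(e : PadicAlgCl 2)‖ := norm_pos_iff.mpr he'
  have hν1 : ‖(e : PadicAlgCl 2)‖ ≤ 1 := norm_natCast_le_one e
  have hm : 0 < ‖a * e * γ‖ := norm_pos_iff.mpr (mul_ne_zero (mul_ne_zero ha he') hγ)
  have hapos : 0 < ‖a‖ := norm_pos_iff.mpr ha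
  refine ⟨(1 + 6 * (1 + (‖c₁‖ + ‖c₂‖) ^ 2) / (‖a‖ * ‖(e : PadicAlgCl 2)‖ ^ 2)
      + ‖c₁‖ * (1 + (‖c₁‖ + ‖c₂‖)) / (‖a‖ * ‖(e : PadicAlgCl 2)‖)) / ‖a * e * γ‖,
    div_pos (by positivity) hm, ?_⟩
  intro t δ hδ0 hδ1 u hu hΦ
  have hna := PadicAlgCl.isNonarchimedean 2
  -- every root has absolute value 1
  have hζnorm : ∀ ζ ∈ T, ‖ζ‖ = 1 := fun ζ hζ => by
    have h1 := congrArg norm (hroot ζ hζ)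
    rw [norm_pow, hγ1] at h1
    exact (pow_eq_one_iff_of_nonneg (norm_nonneg _) he).mp h1
  -- the nearest root
  obtain ⟨ζ, hζT, hmin⟩ := T.exists_min_image (fun ζ => ‖u - ζ‖) hTne
  refine ⟨ζ, hroot ζ hζT, ?_⟩
  have hζ1 : ‖ζ‖ = 1 := hζnorm ζ hζT
  have hγζ : ζ ^ e = γ := hroot ζ hζT
  have hh1 : ‖u - ζ‖ ≤ 1 := by
    calc ‖u - ζ‖ = ‖u + -ζ‖ := by rw [sub_eq_add_neg]
      _ ≤ max ‖u‖ ‖-ζ‖ := hna u (-ζ)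
      _ = 1 := by rw [norm_neg, hu, hζ1, max_self]
  -- Step S1: ‖a‖·‖u^e − γ‖ ≤ δ + 2^{-t}·κ
  have h2t : ‖(2 : PadicAlgCl 2) ^ t‖ = (1 / 2 : ℝ) ^ t := norm_two_pow t
  have hs0 : (0 : ℝ) ≤ (1 / 2 : ℝ) ^ t := by positivity
  have hs1 : (1 / 2 : ℝ) ^ t ≤ 1 := pow_le_one₀ (by norm_num) (by norm_num)
  have hss : ((1 / 2 : ℝ) ^ t) ^ 2 = (1 / 4 : ℝ) ^ t := by
    rw [← pow_mul, mul_comm, pow_mul]; norm_num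
  have hue : ‖u ^ e‖ = 1 := by rw [norm_pow, hu, one_pow]
  have hcu : ‖c₁ * u ^ e + c₂‖ ≤ ‖c₁‖ + ‖c₂‖ :=
    (norm_add_le _ _).trans (by rw [norm_mul, hue, mul_one])
  have hw : ‖a‖ * ‖u ^ e - γ‖ ≤ δ + (1 / 2 : ℝ) ^ t * (‖c₁‖ + ‖c₂‖) := by
    have h1 : a * u * (u ^ e - γ) = (a * u * (u ^ e - γ) + (2 : PadicAlgCl 2) ^ t * (c₁ * u ^ e + c₂))
        + -((2 : PadicAlgCl 2) ^ t * (c₁ * u ^ e + c₂)) := by ring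
    have h2 : ‖a * u * (u ^ e - γ)‖ ≤ max δ ((1 / 2 : ℝ) ^ t * (‖c₁‖ + ‖c₂‖)) := by
      rw [h1]
      refine (hna _ _).trans (max_le_max hΦ ?_)
      rw [norm_neg, norm_mul, h2t]
      exact mul_le_mul_of_nonneg_left hcu hs0
    have h3 : ‖a * u * (u ^ e - γ)‖ = ‖a‖ * ‖u ^ e - γ‖ := by rw [norm_mul, norm_mul, hu, mul_one]
    rw [← h3]
    exact h2.trans (max_le (le_add_of_nonneg_right (by positivity)) (le_add_of_nonneg_left hδ0))
  -- Step S2: ‖u − ζ‖·‖e‖ ≤ ‖u^e − γ‖ (the other roots stay at their mutual distance from ζ)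
  have hfac : ‖u ^ e - γ‖ = ‖u - ζ‖ * ∏ ζ' ∈ T.erase ζ, ‖u - ζ'‖ := by
    rw [hprod u, norm_prod, ← Finset.mul_prod_erase T (fun x => ‖u - x‖) hζT]
  have hνeq : ‖(e : PadicAlgCl 2)‖ = ∏ ζ' ∈ T.erase ζ, ‖ζ - ζ'‖ := by
    rw [← norm_prod, hder ζ hζT, norm_mul, norm_pow, hζ1, one_pow, mul_one]
  have hprod_le : ∏ ζ' ∈ T.erase ζ, ‖ζ - ζ'‖ ≤ ∏ ζ' ∈ T.erase ζ, ‖u - ζ'‖ := by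
    refine Finset.prod_le_prod (fun _ _ => norm_nonneg _) fun ζ' hζ' => ?_
    have hζ'T : ζ' ∈ T := Finset.mem_of_mem_erase hζ'
    have e1 : ζ - ζ' = (u - ζ') + -(u - ζ) := by ring
    calc ‖ζ - ζ'‖ = ‖(u - ζ') + -(u - ζ)‖ := by rw [e1]
      _ ≤ max ‖u - ζ'‖ ‖-(u - ζ)‖ := hna _ _
      _ = ‖u - ζ'‖ := by rw [norm_neg]; exact max_eq_left (hmin ζ' hζ'T)
  have hhν : ‖u - ζ‖ * ‖(e : PadicAlgCl 2)‖ ≤ ‖u ^ e - γ‖ := by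
    rw [hfac, hνeq]
    exact mul_le_mul_of_nonneg_left hprod_le (norm_nonneg _)
  have hh_le : ‖u - ζ‖ ≤ (δ + (1 / 2 : ℝ) ^ t * (‖c₁‖ + ‖c₂‖)) / (‖a‖ * ‖(e : PadicAlgCl 2)‖) := by
    rw [le_div_iff₀ (by positivity)]
    calc ‖u - ζ‖ * (‖a‖ * ‖(e : PadicAlgCl 2)‖) = ‖a‖ * (‖u - ζ‖ * ‖(e : PadicAlgCl 2)‖) := by ring
      _ ≤ ‖a‖ * ‖u ^ e - γ‖ := mul_le_mul_of_nonneg_left hhν (norm_nonneg _)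
      _ ≤ _ := hw
  -- Step S3: the algebraic identities behind the linearisation
  have HG1 : (∑ i ∈ Finset.range e, u ^ i * ζ ^ (e - 1 - i)) * (u - ζ) = u ^ e - ζ ^ e :=
    (Commute.all u ζ).geom_sum₂_mul e
  have HG2 : (∑ i ∈ Finset.range e, u ^ i * ζ ^ (e - 1 - i)) - (e : PadicAlgCl 2) * ζ ^ (e - 1)
      = (u - ζ) * ∑ i ∈ Finset.range e, (∑ j ∈ Finset.range i, u ^ j * ζ ^ (i - 1 - j)) * ζ ^ (e - 1 - i) := by
    have key : ∀ i ∈ Finset.range e, u ^ i * ζ ^ (e - 1 - i) - ζ ^ (e - 1)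
        = (u - ζ) * ((∑ j ∈ Finset.range i, u ^ j * ζ ^ (i - 1 - j)) * ζ ^ (e - 1 - i)) := by
      intro i hi
      have hgi : (∑ j ∈ Finset.range i, u ^ j * ζ ^ (i - 1 - j)) * (u - ζ) = u ^ i - ζ ^ i :=
        (Commute.all u ζ).geom_sum₂_mul i
      have hpow : ζ ^ (e - 1) = ζ ^ i * ζ ^ (e - 1 - i) := by
        rw [← pow_add]; congr 1; have := Finset.mem_range.mp hi; omega
      rw [hpow]
      linear_combination (-(ζ ^ (e - 1 - i))) * hgi
    have hconst : (e : PadicAlgCl 2) * ζ ^ (e - 1) = ∑ i ∈ Finset.range e, ζ ^ (e - 1) := by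
      rw [Finset.sum_const, Finset.card_range, nsmul_eq_mul]
    rw [hconst, ← Finset.sum_sub_distrib, Finset.mul_sum]
    exact Finset.sum_congr rfl key
  -- norm bounds for the two sums
  have hterm : ∀ i j : ℕ, ‖u ^ i * ζ ^ j‖ ≤ 1 := fun i j => by
    rw [norm_mul, norm_pow, norm_pow, hu, hζ1, one_pow, one_pow, mul_one]
  have hG1n : ‖∑ i ∈ Finset.range e, u ^ i * ζ ^ (e - 1 - i)‖ ≤ 1 :=
    IsUltrametricDist.norm_sum_le_of_forall_le_of_nonneg zero_le_one fun i _ => hterm i _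
  have hG2n : ‖∑ i ∈ Finset.range e, (∑ j ∈ Finset.range i, u ^ j * ζ ^ (i - 1 - j)) * ζ ^ (e - 1 - i)‖ ≤ 1 :=
    IsUltrametricDist.norm_sum_le_of_forall_le_of_nonneg zero_le_one fun i _ => by
      rw [norm_mul, norm_pow, hζ1, one_pow, mul_one]
      exact IsUltrametricDist.norm_sum_le_of_forall_le_of_nonneg zero_le_one fun j _ => hterm j _
  -- abbreviations (plain `have … = …` equalities, to keep the terms readable)
  obtain ⟨G₁, hG₁⟩ : ∃ G₁ : PadicAlgCl 2, G₁ = ∑ i ∈ Finset.range e, u ^ i * ζ ^ (e - 1 - i) := ⟨_, rfl⟩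
  obtain ⟨G₂, hG₂⟩ : ∃ G₂ : PadicAlgCl 2,
      G₂ = ∑ i ∈ Finset.range e, (∑ j ∈ Finset.range i, u ^ j * ζ ^ (i - 1 - j)) * ζ ^ (e - 1 - i) := ⟨_, rfl⟩
  rw [← hG₁] at HG1 HG2 hG1n
  rw [← hG₂] at HG2 hG2n
  -- I1: u·(u^e − γ) = e·γ·h + h²·R₁,  I2: c₁u^e + c₂ = (c₁γ + c₂) + c₁·G₁·h
  have I1 : u * (u ^ e - γ) = (e : PadicAlgCl 2) * γ * (u - ζ)
      + (u - ζ) ^ 2 * (ζ * G₂ + (e : PadicAlgCl 2) * ζ ^ (e - 1) + (u - ζ) * G₂) := by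
    have hpow' : ζ ^ e = ζ ^ (e - 1) * ζ := by
      rw [← pow_succ]; congr 1; omega
    rw [← hγζ]
    linear_combination (-u) * HG1 + ((u - ζ) * u) * HG2 + (-((u - ζ) * (e : PadicAlgCl 2))) * hpow'
  have I2 : c₁ * u ^ e + c₂ = (c₁ * γ + c₂) + c₁ * G₁ * (u - ζ) := by
    rw [← hγζ]
    linear_combination (-c₁) * HG1
  have hR1 : ‖ζ * G₂ + (e : PadicAlgCl 2) * ζ ^ (e - 1) + (u - ζ) * G₂‖ ≤ 3 := by
    have h1 : ‖ζ * G₂‖ ≤ 1 := by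
      rw [norm_mul, hζ1, one_mul]; exact hG2n
    have h2 : ‖(e : PadicAlgCl 2) * ζ ^ (e - 1)‖ ≤ 1 := by
      rw [norm_mul, norm_pow, hζ1, one_pow, mul_one]; exact hν1
    have h3 : ‖(u - ζ) * G₂‖ ≤ 1 := by
      rw [norm_mul]; exact mul_le_one₀ hh1 (norm_nonneg _) hG2n
    linarith [norm_add₃_le (a := ζ * G₂) (b := (e : PadicAlgCl 2) * ζ ^ (e - 1)) (c := (u - ζ) * G₂)]
  -- the main identity: (a·e·γ)·(h + 2^t θ) = Φ − a·h²·R₁ − 2^t·c₁·G₁·h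
  have hθ : a * e * γ * ((c₁ * γ + c₂) / (a * e * γ)) = c₁ * γ + c₂ :=
    mul_div_cancel₀ _ (mul_ne_zero (mul_ne_zero ha he') hγ)
  have main : a * e * γ * (u + (2 : PadicAlgCl 2) ^ t * ((c₁ * γ + c₂) / (a * e * γ)) - ζ)
      = (a * u * (u ^ e - γ) + (2 : PadicAlgCl 2) ^ t * (c₁ * u ^ e + c₂))
        + -(a * ((u - ζ) ^ 2 * (ζ * G₂ + (e : PadicAlgCl 2) * ζ ^ (e - 1) + (u - ζ) * G₂)))
        + -((2 : PadicAlgCl 2) ^ t * (c₁ * G₁ * (u - ζ))) := by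
    linear_combination (-a) * I1 - (2 : PadicAlgCl 2) ^ t * I2 + (2 : PadicAlgCl 2) ^ t * hθ
  -- norm of the main identity
  have hX : ‖a * e * γ‖ * ‖u + (2 : PadicAlgCl 2) ^ t * ((c₁ * γ + c₂) / (a * e * γ)) - ζ‖
      ≤ δ + 3 * ‖a‖ * ‖u - ζ‖ ^ 2 + (1 / 2 : ℝ) ^ t * ‖c₁‖ * ‖u - ζ‖ := by
    rw [← norm_mul, main]
    refine (norm_add₃_le).trans ?_
    have h1 : ‖-(a * ((u - ζ) ^ 2 * (ζ * G₂ + (e : PadicAlgCl 2) * ζ ^ (e - 1) + (u - ζ) * G₂)))‖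
        ≤ 3 * ‖a‖ * ‖u - ζ‖ ^ 2 := by
      rw [norm_neg, norm_mul, norm_mul, norm_pow]
      calc ‖a‖ * (‖u - ζ‖ ^ 2 * ‖ζ * G₂ + (e : PadicAlgCl 2) * ζ ^ (e - 1) + (u - ζ) * G₂‖)
          ≤ ‖a‖ * (‖u - ζ‖ ^ 2 * 3) := by gcongr
        _ = 3 * ‖a‖ * ‖u - ζ‖ ^ 2 := by ring
    have h2 : ‖-((2 : PadicAlgCl 2) ^ t * (c₁ * G₁ * (u - ζ)))‖ ≤ (1 / 2 : ℝ) ^ t * ‖c₁‖ * ‖u - ζ‖ := by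
      rw [norm_neg, norm_mul, h2t, norm_mul, norm_mul]
      calc (1 / 2 : ℝ) ^ t * (‖c₁‖ * ‖G₁‖ * ‖u - ζ‖) ≤ (1 / 2 : ℝ) ^ t * (‖c₁‖ * 1 * ‖u - ζ‖) := by gcongr
        _ = (1 / 2 : ℝ) ^ t * ‖c₁‖ * ‖u - ζ‖ := by ring
    linarith
  -- Step S4: real arithmetic
  have hκ0 : 0 ≤ ‖c₁‖ + ‖c₂‖ := by positivity
  have hL0 : 0 ≤ ‖u - ζ‖ := norm_nonneg _
  have e1 : (δ + (1 / 2 : ℝ) ^ t * (‖c₁‖ + ‖c₂‖)) ^ 2 ≤ 2 * (1 + (‖c₁‖ + ‖c₂‖) ^ 2) * (δ + (1 / 4 : ℝ) ^ t) := by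
    rw [← hss]
    nlinarith [sq_nonneg (δ - (1 / 2 : ℝ) ^ t * (‖c₁‖ + ‖c₂‖)), mul_nonneg hδ0 (sq_nonneg (‖c₁‖ + ‖c₂‖)),
      mul_le_mul_of_nonneg_left hδ1 hδ0, sq_nonneg ((1 / 2 : ℝ) ^ t)]
  have hB1 : 3 * ‖a‖ * ‖u - ζ‖ ^ 2
      ≤ 6 * (1 + (‖c₁‖ + ‖c₂‖) ^ 2) / (‖a‖ * ‖(e : PadicAlgCl 2)‖ ^ 2) * (δ + (1 / 4 : ℝ) ^ t) := by
    have h1 : ‖u - ζ‖ ^ 2 ≤ ((δ + (1 / 2 : ℝ) ^ t * (‖c₁‖ + ‖c₂‖)) / (‖a‖ * ‖(e : PadicAlgCl 2)‖)) ^ 2 :=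
      pow_le_pow_left₀ hL0 hh_le 2
    calc 3 * ‖a‖ * ‖u - ζ‖ ^ 2
        ≤ 3 * ‖a‖ * ((δ + (1 / 2 : ℝ) ^ t * (‖c₁‖ + ‖c₂‖)) / (‖a‖ * ‖(e : PadicAlgCl 2)‖)) ^ 2 := by gcongr
      _ = 3 * (δ + (1 / 2 : ℝ) ^ t * (‖c₁‖ + ‖c₂‖)) ^ 2 / (‖a‖ * ‖(e : PadicAlgCl 2)‖ ^ 2) := by
          field_simp
      _ ≤ 3 * (2 * (1 + (‖c₁‖ + ‖c₂‖) ^ 2) * (δ + (1 / 4 : ℝ) ^ t)) / (‖a‖ * ‖(e : PadicAlgCl 2)‖ ^ 2) := by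
          gcongr
      _ = _ := by ring
  have hB2 : (1 / 2 : ℝ) ^ t * ‖c₁‖ * ‖u - ζ‖
      ≤ ‖c₁‖ * (1 + (‖c₁‖ + ‖c₂‖)) / (‖a‖ * ‖(e : PadicAlgCl 2)‖) * (δ + (1 / 4 : ℝ) ^ t) := by
    have h0 : 0 ≤ ((1 / 2 : ℝ) ^ t) ^ 2 + (‖c₁‖ + ‖c₂‖) * δ := by positivity
    have h1 : (1 / 2 : ℝ) ^ t * (δ + (1 / 2 : ℝ) ^ t * (‖c₁‖ + ‖c₂‖))
        ≤ (1 + (‖c₁‖ + ‖c₂‖)) * (δ + (1 / 4 : ℝ) ^ t) := by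
      rw [← hss]
      calc (1 / 2 : ℝ) ^ t * (δ + (1 / 2 : ℝ) ^ t * (‖c₁‖ + ‖c₂‖))
          = (1 / 2 : ℝ) ^ t * δ + ((1 / 2 : ℝ) ^ t) ^ 2 * (‖c₁‖ + ‖c₂‖) := by ring
        _ ≤ δ + ((1 / 2 : ℝ) ^ t) ^ 2 * (‖c₁‖ + ‖c₂‖) :=
            add_le_add_left (mul_le_of_le_one_left hδ0 hs1) _
        _ ≤ δ + ((1 / 2 : ℝ) ^ t) ^ 2 * (‖c₁‖ + ‖c₂‖) + (((1 / 2 : ℝ) ^ t) ^ 2 + (‖c₁‖ + ‖c₂‖) * δ) :=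
            le_add_of_nonneg_right h0
        _ = (1 + (‖c₁‖ + ‖c₂‖)) * (δ + ((1 / 2 : ℝ) ^ t) ^ 2) := by ring
    have h2 : (1 / 2 : ℝ) ^ t * ‖u - ζ‖
        ≤ (1 / 2 : ℝ) ^ t * ((δ + (1 / 2 : ℝ) ^ t * (‖c₁‖ + ‖c₂‖)) / (‖a‖ * ‖(e : PadicAlgCl 2)‖)) :=
      mul_le_mul_of_nonneg_left hh_le hs0
    have h3 : (1 / 2 : ℝ) ^ t * ((δ + (1 / 2 : ℝ) ^ t * (‖c₁‖ + ‖c₂‖)) / (‖a‖ * ‖(e : PadicAlgCl 2)‖))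
        ≤ (1 + (‖c₁‖ + ‖c₂‖)) * (δ + (1 / 4 : ℝ) ^ t) / (‖a‖ * ‖(e : PadicAlgCl 2)‖) := by
      rw [← mul_div_assoc]
      exact div_le_div_of_nonneg_right h1 (by positivity)
    calc (1 / 2 : ℝ) ^ t * ‖c₁‖ * ‖u - ζ‖ = ‖c₁‖ * ((1 / 2 : ℝ) ^ t * ‖u - ζ‖) := by ring
      _ ≤ ‖c₁‖ * ((1 + (‖c₁‖ + ‖c₂‖)) * (δ + (1 / 4 : ℝ) ^ t) / (‖a‖ * ‖(e : PadicAlgCl 2)‖)) :=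
          mul_le_mul_of_nonneg_left (h2.trans h3) (norm_nonneg _)
      _ = _ := by ring
  have hδle : δ ≤ 1 * (δ + (1 / 4 : ℝ) ^ t) := by rw [one_mul]; exact le_add_of_nonneg_right (by positivity)
  rw [div_mul_eq_mul_div, le_div_iff₀ hm, mul_comm]
  calc ‖a * e * γ‖ * ‖u + (2 : PadicAlgCl 2) ^ t * ((c₁ * γ + c₂) / (a * e * γ)) - ζ‖
      ≤ δ + 3 * ‖a‖ * ‖u - ζ‖ ^ 2 + (1 / 2 : ℝ) ^ t * ‖c₁‖ * ‖u - ζ‖ := hX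
    _ ≤ 1 * (δ + (1 / 4 : ℝ) ^ t)
        + 6 * (1 + (‖c₁‖ + ‖c₂‖) ^ 2) / (‖a‖ * ‖(e : PadicAlgCl 2)‖ ^ 2) * (δ + (1 / 4 : ℝ) ^ t)
        + ‖c₁‖ * (1 + (‖c₁‖ + ‖c₂‖)) / (‖a‖ * ‖(e : PadicAlgCl 2)‖) * (δ + (1 / 4 : ℝ) ^ t) := by
          linarith
    _ = _ := by ring

/-! ## Step 5 of the blueprint: one-prime integer Ridout finishes

PORT (census g19, VERDICT L2278 / critic L2282 (d)): the Ridout input is the tree's PROVED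
`Literature.NumberTheory.DiophantineApproximation.Ridout.padicRoth_int`, applied BY NAME inside `ridout_step` (K carried it as a
hypothesis `(hR : PadicRothInt)` because the farm snapshot of g45 had the module unbuilt; binder removed at port, no def lands). -/

/-- **Ridout step (blueprint Step 5).**  Integers `Z` of size `≤ C₀·2^t` lying within `C₁·(2^{−t})^ρ`, `ρ > 1`, of
`L·ζ` for some `ζ` in a fixed finite set of algebraic elements of `\overline{ℚ₂}` form a finite set. -/
theorem ridout_step (T : Finset (PadicAlgCl 2)) (halg : ∀ ζ ∈ T, IsAlgebraic ℚ ζ)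
    (L : ℤ) {ρ C₀ C₁ : ℝ} (hρ : 1 < ρ) (hC₀ : 0 < C₀) (hC₁ : 0 < C₁) :
    {Z : ℤ | ∃ t : ℕ, |(Z : ℝ)| ≤ C₀ * 2 ^ t ∧
      ∃ ζ ∈ T, ‖(Z : PadicAlgCl 2) - L * ζ‖ ≤ C₁ * ((1 / 2 : ℝ) ^ t) ^ ρ}.Finite := by
  classical
  set ε : ℝ := (ρ - 1) / 2 with hεdef
  have hε : 0 < ε := by rw [hεdef]; linarith
  -- Ridout's exceptional set for the target `L·ζ`, one for each `ζ ∈ T`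
  have hfin : ∀ ζ ∈ T, {n : ℤ | min (1 : ℝ) ‖(n : PadicAlgCl 2) - L * ζ‖ < |(n : ℝ)| ^ (-(1 + ε))}.Finite := by
    intro ζ hζ
    let α : ∀ p : Nat.Primes, @PadicAlgCl (p : ℕ) ⟨p.2⟩ := fun p =>
      if hp : p = pTwo then (by subst hp; exact (L : PadicAlgCl 2) * ζ) else 0
    have hα : α pTwo = (L : PadicAlgCl 2) * ζ := by
      show (if hp : pTwo = pTwo then _ else _) = _
      rw [dif_pos rfl]
    have hαalg : ∀ p ∈ ({pTwo} : Finset Nat.Primes), IsAlgebraic ℚ (α p) := by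
      intro p hp
      rw [Finset.mem_singleton] at hp
      subst hp
      rw [hα]
      have hL : IsAlgebraic ℚ (L : PadicAlgCl 2) := by
        rw [show (L : PadicAlgCl 2) = algebraMap ℚ (PadicAlgCl 2) (L : ℚ) from (map_intCast _ L).symm]
        exact isAlgebraic_algebraMap _
      exact hL.mul (halg ζ hζ)
    have hF := Literature.NumberTheory.DiophantineApproximation.Ridout.padicRoth_int {pTwo} α hαalg hε
    refine hF.subset fun n hn => ?_
    show (∏ p ∈ ({pTwo} : Finset Nat.Primes), min (1 : ℝ) ‖((n : ℤ) : @PadicAlgCl (p : ℕ) ⟨p.2⟩) - α p‖) <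
      |((n : ℤ) : ℝ)| ^ (-(1 + ε))
    rw [Finset.prod_singleton]
    have h1 : min (1 : ℝ) ‖((n : ℤ) : PadicAlgCl 2) - α pTwo‖ = min (1 : ℝ) ‖(n : PadicAlgCl 2) - L * ζ‖ := by
      rw [hα]
    exact h1.trans_lt hn
  -- threshold beyond which the hypothesis beats `|Z|^{-(1+ε)}`
  set B : ℝ := (C₁ * C₀ ^ ρ) ^ ε⁻¹ with hBdef
  have hK : 0 < C₁ * C₀ ^ ρ := mul_pos hC₁ (Real.rpow_pos_of_pos hC₀ ρ)
  have hsmall : {Z : ℤ | |(Z : ℝ)| ≤ B}.Finite := by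
    refine (Set.finite_Icc (-⌈B⌉) ⌈B⌉).subset fun Z hZ => ?_
    have hZ' : |(Z : ℝ)| ≤ B := hZ
    have h1 := abs_le.mp hZ'
    constructor
    · have : (-⌈B⌉ : ℤ) ≤ Z := by
        have h2 : (-(⌈B⌉ : ℝ)) ≤ (Z : ℝ) := le_trans (neg_le_neg (Int.le_ceil B)) h1.1
        exact_mod_cast h2
      exact this
    · have h2 : (Z : ℝ) ≤ ⌈B⌉ := h1.2.trans (Int.le_ceil B)
      exact_mod_cast h2
  refine (hsmall.union (Set.Finite.biUnion T.finite_toSet hfin)).subset ?_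
  rintro Z ⟨t, hZt, ζ, hζT, hZζ⟩
  by_cases hZB : |(Z : ℝ)| ≤ B
  · exact Or.inl hZB
  right
  rw [Set.mem_iUnion₂]
  refine ⟨ζ, hζT, ?_⟩
  have hBpos : 0 ≤ B := by rw [hBdef]; positivity
  have hZpos : 0 < |(Z : ℝ)| := lt_of_le_of_lt hBpos (not_le.mp hZB)
  -- (1/2)^t ≤ C₀/|Z|
  have hhalf : (1 / 2 : ℝ) ^ t ≤ C₀ / |(Z : ℝ)| := by
    rw [le_div_iff₀ hZpos, one_div_pow, one_div_mul_eq_div, div_le_iff₀ (by positivity)]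
    exact hZt
  have hpow : ((1 / 2 : ℝ) ^ t) ^ ρ ≤ (C₀ / |(Z : ℝ)|) ^ ρ :=
    Real.rpow_le_rpow (by positivity) hhalf (by linarith)
  have hsplit : (C₀ / |(Z : ℝ)|) ^ ρ = C₀ ^ ρ * |(Z : ℝ)| ^ (-ρ) := by
    rw [Real.div_rpow hC₀.le hZpos.le, Real.rpow_neg hZpos.le, div_eq_mul_inv]
  -- |Z|^ε > C₁ C₀^ρ
  have hZε : C₁ * C₀ ^ ρ < |(Z : ℝ)| ^ ε := by
    have h1 : B < |(Z : ℝ)| := not_le.mp hZB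
    have h2 : B ^ ε < |(Z : ℝ)| ^ ε := Real.rpow_lt_rpow hBpos h1 hε
    rwa [hBdef, Real.rpow_inv_rpow hK.le hε.ne'] at h2
  have hexp : |(Z : ℝ)| ^ (-(1 + ε)) = |(Z : ℝ)| ^ (-ρ) * |(Z : ℝ)| ^ ε := by
    rw [← Real.rpow_add hZpos]; congr 1; rw [hεdef]; ring
  calc min (1 : ℝ) ‖(Z : PadicAlgCl 2) - L * ζ‖ ≤ ‖(Z : PadicAlgCl 2) - L * ζ‖ := min_le_right _ _
    _ ≤ C₁ * ((1 / 2 : ℝ) ^ t) ^ ρ := hZζ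
    _ ≤ C₁ * (C₀ ^ ρ * |(Z : ℝ)| ^ (-ρ)) := by rw [← hsplit]; exact mul_le_mul_of_nonneg_left hpow hC₁.le
    _ = |(Z : ℝ)| ^ (-ρ) * (C₁ * C₀ ^ ρ) := by ring
    _ < |(Z : ℝ)| ^ (-ρ) * |(Z : ℝ)| ^ ε := mul_lt_mul_of_pos_left hZε (Real.rpow_pos_of_pos hZpos _)
    _ = |(Z : ℝ)| ^ (-(1 + ε)) := hexp.symm

end Summit.Schanuel.Schanuel.Theorems.RootDecomp1KXLinearCore
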